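import Summits.RiemannHypothesis.RiemannHypothesis.Theorems.HardyZLehmerSplitSigmaLLaguerreEnergy
import Literature.Analysis.SpecialFunctions.DigammaStirlingSeries
import HarnessLib

/-!
# Crux `SigmaL` (stmt-RiemannHypothesis-24253) — energy identity, part 4: the Gamma drift EXACTLY
# (`c'(t) = 2(t²−¼)/(t²+¼)² + ¼ Re ψ'(¼+it/2)`, `1/(t²+¼) ≤ c'(t) ≤ 3/(t²+¼)`) and the VIOLATION MECHANISM

Skeleton `SigmaL_birth`, registered stub `stub_laguerreAtCritical : ∀ t > 3·10¹², Z'(t) = 0 → Z(t) ≠ 0 →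
Z(t)·Z''(t) < 0` (RH-strength, OPEN). Part 2 (`Theorems/HardyZLehmerSplitSigmaLLaguerreEnergy.lean`)
proved the energy identity `(Z''Z − Z'²)/Z²(t) = Σₙ Re Zₙ(1, ½+it) + c'(t)` with the one-sided drift bound
`c'(t) ≤ 4/t`. Here the drift is pinned down:

* §8 `hasDerivAt_drift_explicit`, `laguerre_sub_tsum_re_zeroTerm_eq`: `c'(t) = 2(t²−¼)/(t²+¼)² + ¼ Re ψ'(¼+it/2)`
  EXACTLY (chain rule; `ψ` analytic on `Re > 0`), and `abs_re_deriv_digamma_quarterLine_sub_le`: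
  `|Re ψ'(¼+it/2) − (1/(t²+¼) − 2(t²−¼)/(t²+¼)²)| ≤ 12/((t²+¼)t)` from the tree's Stirling series for `ψ'`
  with explicit remainder (`Literature.Analysis.SpecialFunctions.Complex.norm_deriv_digamma_sub_stirlingSeries_le`,
  order `ν = 1`);
* §9 `drift_bounds`: `1/(t²+¼) ≤ c'(t) ≤ 3/(t²+¼)` for `t ≥ 6` (so `c'(t) ≈ 1.75/t² > 0`); hence the SHARP
  energy inequality `(Z Z'' − Z'²)/Z² ≤ Σₙ Re Zₙ + 3/(t²+¼)` (`laguerre_le_tsum_re_zeroTerm_add_sharp`), the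
  NEW LOWER inequality `Σₙ Re Zₙ + 1/(t²+¼) ≤ (Z Z'' − Z'²)/Z²` (`tsum_re_zeroTerm_add_le_laguerre`), and at
  critical points: energy `> 3/(t²+¼)` ⇒ `Z·Z'' < 0` (`laguerreAtCritical_of_energy_sharp`), energy
  `< 1/(t²+¼)` ⇒ `Z·Z'' > 0` (`wrongCurvature_of_energyDeficit`) ⇒ a LEHMER VIOLATION at `t`
  (`lehmerViolation_of_energyDeficit`); `laguerreAtCritical_energy_dichotomy` records both sides.

NOTHING HERE PROVES OR ASSUMES RH; the stub and the crux stay OPEN.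
References: Ivić 2003 §2 Prop. 1 [Ivic2003]; Andrews–Askey–Roy, Special Functions, Cor. 1.4.5 (Stirling for
`ψ′`) [AndrewsAskeyRoy1999].
-/

noncomputable section

set_option linter.dupNamespace false
set_option autoImplicit false

open Complex Filter Set
open scoped Real Topology
open Literature.NumberTheory.LFunctions
open Literature.NumberTheory.LFunctions.Stark1974

namespace Summit.RiemannHypothesis.RiemannHypothesis.Theorems.SigmaLBirth

variable (D : SymmHadamardData riemannXi)

/-! ## §8. The drift EXACTLY: `c'(t) = 2(t²−¼)/(t²+¼)² + ¼ Re ψ'(¼ + it/2)` -/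

/-- The point `w(u) = ¼ + iu/2` moves with velocity `i/2`. [folklore] -/
theorem hasDerivAt_quarterLinePt (t : ℝ) :
    HasDerivAt (fun u : ℝ ↦ (1 / 4 : ℂ) + ((u / 2 : ℝ) : ℂ) * I) (((1 / 2 : ℝ) : ℂ) * I) t := by
  have h : HasDerivAt (fun u : ℝ ↦ ((u / 2 : ℝ) : ℂ) * I) (((1 / 2 : ℝ) : ℂ) * I) t := by
    have h0 : HasDerivAt (fun u : ℝ ↦ u / 2) (1 / 2) t := by
      simpa using (hasDerivAt_id t).div_const 2
    exact h0.ofReal_comp.mul_const I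
  simpa using h.const_add (1 / 4 : ℂ)

/-- **The drift differentiated explicitly:** `c(u) = −2u/(u²+¼) + ½ Im ψ(¼ + iu/2)` has
`c'(t) = 2(t²−¼)/(t²+¼)² + ¼ Re ψ'(¼ + it/2)` (`ψ` is analytic on `Re > 0`,
`analyticAt_digamma_of_re_pos`). [folklore] -/
theorem hasDerivAt_drift_explicit (t : ℝ) :
    HasDerivAt (fun u : ℝ ↦ -(2 * u / (u ^ 2 + 1 / 4)) +
        (Complex.digamma ((1 / 4 : ℂ) + ((u / 2 : ℝ) : ℂ) * I)).im / 2)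
      (2 * (t ^ 2 - 1 / 4) / (t ^ 2 + 1 / 4) ^ 2 +
        (deriv Complex.digamma ((1 / 4 : ℂ) + ((t / 2 : ℝ) : ℂ) * I)).re / 4) t := by
  -- rational part
  have h1 : HasDerivAt (fun u : ℝ ↦ 2 * u / (u ^ 2 + 1 / 4))
      ((2 * (t ^ 2 + 1 / 4) - 2 * t * (2 * t)) / (t ^ 2 + 1 / 4) ^ 2) t := by
    have hn : HasDerivAt (fun u : ℝ ↦ 2 * u) 2 t := by
      simpa using (hasDerivAt_id t).const_mul (2 : ℝ)
    have hd : HasDerivAt (fun u : ℝ ↦ u ^ 2 + 1 / 4) (2 * t) t := by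
      simpa using (hasDerivAt_pow 2 t).add_const (1 / 4 : ℝ)
    have hne : t ^ 2 + 1 / 4 ≠ 0 := by positivity
    exact hn.div hd hne
  -- digamma part
  set w : ℂ := (1 / 4 : ℂ) + ((t / 2 : ℝ) : ℂ) * I with hw
  have hwre : 0 < w.re := by simp [hw]
  have hψ : HasDerivAt Complex.digamma (deriv Complex.digamma w) w :=
    (analyticAt_digamma_of_re_pos hwre).differentiableAt.hasDerivAt
  have hcomp : HasDerivAt (fun u : ℝ ↦ Complex.digamma ((1 / 4 : ℂ) + ((u / 2 : ℝ) : ℂ) * I))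
      (deriv Complex.digamma w * (((1 / 2 : ℝ) : ℂ) * I)) t :=
    hψ.comp t (hasDerivAt_quarterLinePt t)
  have him := Complex.imCLM.hasFDerivAt.comp_hasDerivAt t hcomp
  have him' : HasDerivAt (fun u : ℝ ↦ (Complex.digamma ((1 / 4 : ℂ) + ((u / 2 : ℝ) : ℂ) * I)).im)
      ((deriv Complex.digamma w * (((1 / 2 : ℝ) : ℂ) * I)).im) t := by
    simpa only [Function.comp_def, Complex.imCLM_apply] using him
  have hval : (deriv Complex.digamma w * (((1 / 2 : ℝ) : ℂ) * I)).im =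
      (deriv Complex.digamma w).re / 2 := by
    simp [Complex.mul_im]
    ring
  rw [hval] at him'
  refine (h1.neg.add (him'.div_const 2)).congr_deriv ?_
  field_simp
  ring

/-- **The drift in closed form (exact, RH-free):** at every `t` with `Z(t) ≠ 0`,
`(Z''Z − Z'²)/Z²(t) − Σₙ Re Zₙ(1, ½+it) = 2(t²−¼)/(t²+¼)² + ¼ Re ψ'(¼ + it/2)`
(uniqueness of derivatives: `hasDerivAt_drift` and `hasDerivAt_drift_explicit`).
[cite: Ivic2003, §2 (2.1)–(2.2)] -/
theorem laguerre_sub_tsum_re_zeroTerm_eq {t : ℝ} (hZ : hardyZ t ≠ 0) :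
    (deriv (deriv hardyZ) t * hardyZ t - deriv hardyZ t * deriv hardyZ t) / hardyZ t ^ 2 -
        ∑' n, (D.zeroTerm 1 (1 / 2 + (t : ℂ) * I) n).re =
      2 * (t ^ 2 - 1 / 4) / (t ^ 2 + 1 / 4) ^ 2 +
        (deriv Complex.digamma ((1 / 4 : ℂ) + ((t / 2 : ℝ) : ℂ) * I)).re / 4 :=
  (hasDerivAt_drift D hZ).unique (hasDerivAt_drift_explicit t)

/-- **`Re ψ'(¼ + it/2)` by Stirling's series of order 1 with explicit remainder:** for `t > 0`,
`|Re ψ'(¼ + it/2) − (1/(t²+¼) − 2(t²−¼)/(t²+¼)²)| ≤ 12/((t²+¼)·t)`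
(the tree's `norm_deriv_digamma_sub_stirlingSeries_le`, `ν = 1`: main term `1/w + 1/(2w²) + B₂/w³`,
remainder `≤ 4/(π‖w‖³)`; here `Re 1/w = 1/(t²+¼)`, `Re 1/(2w²) = −2(t²−¼)/(t²+¼)²`,
`|Re B₂/w³| ≤ 1/(6‖w‖³)` and `‖w‖³ ≥ (t²+¼)t/8`). [cite: AndrewsAskeyRoy1999, Cor 1.4.5] -/
theorem abs_re_deriv_digamma_quarterLine_sub_le {t : ℝ} (ht : 0 < t) :
    |(deriv Complex.digamma ((1 / 4 : ℂ) + ((t / 2 : ℝ) : ℂ) * I)).re -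
        (1 / (t ^ 2 + 1 / 4) - 2 * (t ^ 2 - 1 / 4) / (t ^ 2 + 1 / 4) ^ 2)| ≤
      12 / ((t ^ 2 + 1 / 4) * t) := by
  set w : ℂ := (1 / 4 : ℂ) + ((t / 2 : ℝ) : ℂ) * I with hw
  have hwre : w.re = 1 / 4 := by simp [hw]
  have hwim : w.im = t / 2 := by simp [hw]
  have hwre' : 0 < w.re := by rw [hwre]; norm_num
  have hS := Literature.Analysis.SpecialFunctions.Complex.norm_deriv_digamma_sub_stirlingSeries_le
    hwre' (ν := 1) one_ne_zero
  have hsum : ∑ k ∈ Finset.Icc 1 1, (bernoulli (2 * k) : ℂ) / w ^ (2 * k + 1) =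
      (6 : ℂ)⁻¹ / w ^ 3 := by
    rw [Finset.Icc_self, Finset.sum_singleton, mul_one, bernoulli_two]
    norm_num
  rw [hsum] at hS
  -- norms of `w`
  have hpos4 : 0 < t ^ 2 + 1 / 4 := by positivity
  have hnsq : Complex.normSq w = (t ^ 2 + 1 / 4) / 4 := by
    rw [Complex.normSq_apply, hwre, hwim]; ring
  have hnorm2 : ‖w‖ ^ 2 = (t ^ 2 + 1 / 4) / 4 := by
    rw [← Complex.normSq_eq_norm_sq, hnsq]
  have him_le : t / 2 ≤ ‖w‖ := by
    have h := Complex.abs_im_le_norm w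
    rwa [hwim, abs_of_pos (by linarith : 0 < t / 2)] at h
  have hnorm_pos : 0 < ‖w‖ := lt_of_lt_of_le (by linarith) him_le
  have hnorm3 : (t ^ 2 + 1 / 4) * t / 8 ≤ ‖w‖ ^ 3 := by
    have e : ‖w‖ ^ 3 = ‖w‖ ^ 2 * ‖w‖ := by ring
    rw [e, hnorm2]
    have := mul_le_mul_of_nonneg_left him_le hpos4.le
    nlinarith
  have hn3pos : 0 < ‖w‖ ^ 3 := by positivity
  -- the Stirling remainder is `4/(π‖w‖³) ≤ (4/3)/‖w‖³`
  have hS' : ‖deriv Complex.digamma w - (1 / w + 1 / (2 * w ^ 2) + (6 : ℂ)⁻¹ / w ^ 3)‖ ≤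
      4 / (Real.pi * ‖w‖ ^ 3) := by
    refine hS.trans (le_of_eq ?_)
    rw [hwre]
    simp only [Nat.factorial, Nat.succ_eq_add_one, Nat.cast_mul, Nat.cast_one, mul_one]
    field_simp
    ring
  have hπ : (3 : ℝ) < Real.pi := Real.pi_gt_three
  have hrem : ‖deriv Complex.digamma w - (1 / w + 1 / (2 * w ^ 2) + (6 : ℂ)⁻¹ / w ^ 3)‖ ≤
      (4 / 3) / ‖w‖ ^ 3 := by
    refine hS'.trans ?_
    rw [div_le_div_iff₀ (by positivity) hn3pos]
    nlinarith
  -- real parts of the main terms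
  have hre1 : (1 / w).re = 1 / (t ^ 2 + 1 / 4) := by
    rw [one_div, Complex.inv_re, hnsq, hwre]
    field_simp
  have hre2 : (1 / (2 * w ^ 2)).re = -(2 * (t ^ 2 - 1 / 4) / (t ^ 2 + 1 / 4) ^ 2) := by
    have e : (1 : ℂ) / (2 * w ^ 2) = (2 : ℂ)⁻¹ * (w ^ 2)⁻¹ := by rw [one_div, mul_inv]
    rw [e, Complex.mul_re, re_inv_sq, hwre, hwim]
    have h2re : ((2 : ℂ)⁻¹).re = 1 / 2 := by simp [Complex.inv_re]
    have h2im : ((2 : ℂ)⁻¹).im = 0 := by simp [Complex.inv_im]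
    rw [h2re, h2im]
    field_simp
    ring
  have hre3 : |((6 : ℂ)⁻¹ / w ^ 3).re| ≤ (1 / 6) / ‖w‖ ^ 3 := by
    refine (Complex.abs_re_le_norm _).trans (le_of_eq ?_)
    rw [norm_div, norm_inv, norm_pow]
    simp
  -- assemble
  have hE := (Complex.abs_re_le_norm
    (deriv Complex.digamma w - (1 / w + 1 / (2 * w ^ 2) + (6 : ℂ)⁻¹ / w ^ 3))).trans hrem
  rw [Complex.sub_re, Complex.add_re, Complex.add_re, hre1, hre2] at hE
  have hinv : 1 / ‖w‖ ^ 3 ≤ 8 / ((t ^ 2 + 1 / 4) * t) := by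
    rw [div_le_div_iff₀ hn3pos (by positivity)]
    nlinarith
  have h3 := abs_le.1 hre3
  have hE' := abs_le.1 hE
  rw [abs_le]
  constructor
  · have : (4 / 3) / ‖w‖ ^ 3 + (1 / 6) / ‖w‖ ^ 3 ≤ 12 / ((t ^ 2 + 1 / 4) * t) := by
      have := mul_le_mul_of_nonneg_left hinv (by norm_num : (0 : ℝ) ≤ 3 / 2)
      have e1 : (4 / 3) / ‖w‖ ^ 3 + (1 / 6) / ‖w‖ ^ 3 = 3 / 2 * (1 / ‖w‖ ^ 3) := by ring
      have e2 : (3 / 2 : ℝ) * (8 / ((t ^ 2 + 1 / 4) * t)) = 12 / ((t ^ 2 + 1 / 4) * t) := by ring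
      linarith
    linarith [h3.1, hE'.1]
  · have : (4 / 3) / ‖w‖ ^ 3 + (1 / 6) / ‖w‖ ^ 3 ≤ 12 / ((t ^ 2 + 1 / 4) * t) := by
      have := mul_le_mul_of_nonneg_left hinv (by norm_num : (0 : ℝ) ≤ 3 / 2)
      have e1 : (4 / 3) / ‖w‖ ^ 3 + (1 / 6) / ‖w‖ ^ 3 = 3 / 2 * (1 / ‖w‖ ^ 3) := by ring
      have e2 : (3 / 2 : ℝ) * (8 / ((t ^ 2 + 1 / 4) * t)) = 12 / ((t ^ 2 + 1 / 4) * t) := by ring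
      linarith
    linarith [h3.2, hE'.2]

/-! ## §9. Two-sided drift `1/(t²+¼) ≤ c'(t) ≤ 3/(t²+¼)` (`t ≥ 6`) and the VIOLATION MECHANISM -/

/-- Numerics, lower side: for `t ≥ 6` the explicit drift minus its Stirling slack is `≥ 1/(t²+¼)`.
[folklore] -/
theorem drift_aux_lower {t : ℝ} (ht : 6 ≤ t) :
    1 / (t ^ 2 + 1 / 4) ≤ 2 * (t ^ 2 - 1 / 4) / (t ^ 2 + 1 / 4) ^ 2 +
      (1 / (t ^ 2 + 1 / 4) - 2 * (t ^ 2 - 1 / 4) / (t ^ 2 + 1 / 4) ^ 2 -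
        12 / ((t ^ 2 + 1 / 4) * t)) / 4 := by
  have ht0 : 0 < t := by linarith
  have hs : 0 < t ^ 2 + 1 / 4 := by positivity
  rw [← sub_nonneg]
  have e : 2 * (t ^ 2 - 1 / 4) / (t ^ 2 + 1 / 4) ^ 2 +
      (1 / (t ^ 2 + 1 / 4) - 2 * (t ^ 2 - 1 / 4) / (t ^ 2 + 1 / 4) ^ 2 -
        12 / ((t ^ 2 + 1 / 4) * t)) / 4 - 1 / (t ^ 2 + 1 / 4) =
      (3 / 4 * t ^ 3 - 3 * t ^ 2 - 9 / 16 * t - 3 / 4) / ((t ^ 2 + 1 / 4) ^ 2 * t) := by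
    field_simp
    ring
  rw [e]
  refine div_nonneg ?_ (by positivity)
  nlinarith [mul_nonneg (mul_nonneg ht0.le ht0.le) (sub_nonneg.2 ht)]

/-- Numerics, upper side: for `t ≥ 6` the explicit drift plus its Stirling slack is `≤ 3/(t²+¼)`.
[folklore] -/
theorem drift_aux_upper {t : ℝ} (ht : 6 ≤ t) :
    2 * (t ^ 2 - 1 / 4) / (t ^ 2 + 1 / 4) ^ 2 +
      (1 / (t ^ 2 + 1 / 4) - 2 * (t ^ 2 - 1 / 4) / (t ^ 2 + 1 / 4) ^ 2 +
        12 / ((t ^ 2 + 1 / 4) * t)) / 4 ≤ 3 / (t ^ 2 + 1 / 4) := by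
  have ht0 : 0 < t := by linarith
  have hs : 0 < t ^ 2 + 1 / 4 := by positivity
  rw [← sub_nonneg]
  have e : 3 / (t ^ 2 + 1 / 4) - (2 * (t ^ 2 - 1 / 4) / (t ^ 2 + 1 / 4) ^ 2 +
      (1 / (t ^ 2 + 1 / 4) - 2 * (t ^ 2 - 1 / 4) / (t ^ 2 + 1 / 4) ^ 2 +
        12 / ((t ^ 2 + 1 / 4) * t)) / 4) =
      (5 / 4 * t ^ 3 - 3 * t ^ 2 + 17 / 16 * t - 3 / 4) / ((t ^ 2 + 1 / 4) ^ 2 * t) := by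
    field_simp
    ring
  rw [e]
  refine div_nonneg ?_ (by positivity)
  nlinarith [mul_nonneg (mul_nonneg ht0.le ht0.le) (sub_nonneg.2 ht)]

/-- **TWO-SIDED DRIFT (RH-free):** for `t ≥ 6` with `Z(t) ≠ 0`,
`1/(t²+¼) ≤ (Z''Z − Z'²)/Z²(t) − Σₙ Re Zₙ(1, ½+it) ≤ 3/(t²+¼)` — the Gamma drift `c'(t)` is POSITIVE,
of exact order `1/t²` (in fact `c'(t) = (3/2)(t²−¼)/(t²+¼)² + 1/(4(t²+¼)) + O(1/t³) ≈ 1.75/t²`); this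
replaces the one-sided `c'(t) ≤ 4/t` and gives the identity BOTH ways. Nothing here bears on the truth of
RH. [cite: Ivic2003, §2 Prop. 1 (energy form, two-sided drift)] -/
theorem drift_bounds {t : ℝ} (ht : 6 ≤ t) (hZ : hardyZ t ≠ 0) :
    1 / (t ^ 2 + 1 / 4) ≤
        (deriv (deriv hardyZ) t * hardyZ t - deriv hardyZ t * deriv hardyZ t) / hardyZ t ^ 2 -
          ∑' n, (D.zeroTerm 1 (1 / 2 + (t : ℂ) * I) n).re ∧
      (deriv (deriv hardyZ) t * hardyZ t - deriv hardyZ t * deriv hardyZ t) / hardyZ t ^ 2 -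
          ∑' n, (D.zeroTerm 1 (1 / 2 + (t : ℂ) * I) n).re ≤ 3 / (t ^ 2 + 1 / 4) := by
  rw [laguerre_sub_tsum_re_zeroTerm_eq D hZ]
  have h := abs_le.1 (abs_re_deriv_digamma_quarterLine_sub_le (by linarith : (0 : ℝ) < t))
  constructor
  · have h1 := drift_aux_lower ht
    linarith [h.1]
  · have h2 := drift_aux_upper ht
    linarith [h.2]

/-- **SHARP ENERGY INEQUALITY (upper, RH-free):** for `t ≥ 6` with `Z(t) ≠ 0`,
`(Z Z'' − Z'²)/Z²(t) ≤ Σₙ Re Zₙ(1, ½+it) + 3/(t²+¼)` (improves the slack `4/t` of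
`laguerre_le_drift_add_tsum_re_zeroTerm` to `3/t²`). Nothing here bears on the truth of RH.
[cite: Ivic2003, §2 Prop. 1 (energy form)] -/
theorem laguerre_le_tsum_re_zeroTerm_add_sharp {t : ℝ} (ht : 6 ≤ t) (hZ : hardyZ t ≠ 0) :
    (hardyZ t * deriv (deriv hardyZ) t - deriv hardyZ t ^ 2) / hardyZ t ^ 2 ≤
      (∑' n, (D.zeroTerm 1 (1 / 2 + (t : ℂ) * I) n).re) + 3 / (t ^ 2 + 1 / 4) := by
  have h := (drift_bounds D ht hZ).2
  have e : (hardyZ t * deriv (deriv hardyZ) t - deriv hardyZ t ^ 2) / hardyZ t ^ 2 =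
      (deriv (deriv hardyZ) t * hardyZ t - deriv hardyZ t * deriv hardyZ t) / hardyZ t ^ 2 := by
    ring
  rw [e]
  linarith

/-- **LOWER ENERGY INEQUALITY (the new direction, RH-free):** for `t ≥ 6` with `Z(t) ≠ 0`,
`Σₙ Re Zₙ(1, ½+it) + 1/(t²+¼) ≤ (Z Z'' − Z'²)/Z²(t)`: the Laguerre expression is never MORE negative
than minus the zero energy — a net energy DEFICIT at `t` (in-cone off-line zeros outweighing all other
zeros) forces the Laguerre inequality to FAIL at `t`. Nothing here bears on the truth of RH.
[cite: Ivic2003, §2 Prop. 1 (energy form, converse direction)] -/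
theorem tsum_re_zeroTerm_add_le_laguerre {t : ℝ} (ht : 6 ≤ t) (hZ : hardyZ t ≠ 0) :
    (∑' n, (D.zeroTerm 1 (1 / 2 + (t : ℂ) * I) n).re) + 1 / (t ^ 2 + 1 / 4) ≤
      (hardyZ t * deriv (deriv hardyZ) t - deriv hardyZ t ^ 2) / hardyZ t ^ 2 := by
  have h := (drift_bounds D ht hZ).1
  have e : (hardyZ t * deriv (deriv hardyZ) t - deriv hardyZ t ^ 2) / hardyZ t ^ 2 =
      (deriv (deriv hardyZ) t * hardyZ t - deriv hardyZ t * deriv hardyZ t) / hardyZ t ^ 2 := by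
    ring
  rw [e]
  linarith

/-- **Sharp sufficient condition at critical points (RH-free):** at a critical point `t ≥ 6` of `Z`
with `Z(t) ≠ 0`, `Σₙ Re Zₙ(1, ½+it) < −3/(t²+¼)` (total zero energy above `3/t²`) gives `Z(t)·Z''(t) < 0`.
The stub stays OPEN; nothing here bears on the truth of RH. [cite: Ivic2003, §2 Prop. 1 (energy form)] -/
theorem laguerreAtCritical_of_energy_sharp {t : ℝ} (ht : 6 ≤ t) (hd : deriv hardyZ t = 0)
    (hZ : hardyZ t ≠ 0) (hE : ∑' n, (D.zeroTerm 1 (1 / 2 + (t : ℂ) * I) n).re < -(3 / (t ^ 2 + 1 / 4))) :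
    hardyZ t * deriv (deriv hardyZ) t < 0 := by
  have h := laguerre_le_tsum_re_zeroTerm_add_sharp D ht hZ
  rw [hd] at h
  have hsq : 0 < hardyZ t ^ 2 := by positivity
  have hneg : (hardyZ t * deriv (deriv hardyZ) t - 0 ^ 2) / hardyZ t ^ 2 < 0 := by linarith
  rw [div_neg_iff] at hneg
  rcases hneg with ⟨_, h2⟩ | ⟨h1, _⟩
  · exact absurd h2 (not_lt.2 hsq.le)
  · simpa using h1

/-- **VIOLATION MECHANISM (RH-free): an energy deficit at a critical point forces wrong curvature.** At a
critical point `t ≥ 6` of `Z` with `Z(t) ≠ 0`, if `Σₙ Re Zₙ(1, ½+it) > −1/(t²+¼)` — the total zero energy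
at `t` is BELOW the drift floor `1/(t²+¼)`, e.g. nonpositive because the off-line zeros whose exact cone
contains `t` outweigh every other zero — then `Z(t)·Z''(t) > 0`. This is the RH-free converse machinery to
the cone theorems: zero geometry ⇒ a Laguerre failure AT AN EXISTING critical point (the existence of the
critical point is a separate matter, cf. the crux `Dictionary`). Nothing here bears on the truth of RH.
[cite: Ivic2003, §2 Prop. 1 (energy form, converse direction)] -/
theorem wrongCurvature_of_energyDeficit {t : ℝ} (ht : 6 ≤ t) (hd : deriv hardyZ t = 0)
    (hZ : hardyZ t ≠ 0) (hE : -(1 / (t ^ 2 + 1 / 4)) < ∑' n, (D.zeroTerm 1 (1 / 2 + (t : ℂ) * I) n).re) :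
    0 < hardyZ t * deriv (deriv hardyZ) t := by
  have h := tsum_re_zeroTerm_add_le_laguerre D ht hZ
  rw [hd] at h
  have hsq : 0 < hardyZ t ^ 2 := by positivity
  have hpos : 0 < (hardyZ t * deriv (deriv hardyZ) t - 0 ^ 2) / hardyZ t ^ 2 := by linarith
  rw [div_pos_iff] at hpos
  rcases hpos with ⟨h1, _⟩ | ⟨_, h2⟩
  · simpa using h1
  · exact absurd h2 (not_lt.2 hsq.le)

/-- **… hence a LEHMER VIOLATION at `t` (RH-free):** under the hypotheses of
`wrongCurvature_of_energyDeficit`, `t` is a positive strict local minimum or a negative strict local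
maximum of Hardy's `Z` (second-derivative test, Mathlib `isLocalMin_of_deriv_deriv_pos` /
`isLocalMax_of_deriv_deriv_neg`) — exactly what the crux `SigmaL` forbids above `3·10¹²`. So: any critical
point of `Z` above `3·10¹²` sitting in a net energy deficit of the zeros refutes `SigmaL` (and RH). Nothing
here bears on the truth of RH. [cite: Ivic2003, §2 Prop. 1 (energy form, converse direction)] -/
theorem lehmerViolation_of_energyDeficit {t : ℝ} (ht : 6 ≤ t) (hd : deriv hardyZ t = 0)
    (hZ : hardyZ t ≠ 0) (hE : -(1 / (t ^ 2 + 1 / 4)) < ∑' n, (D.zeroTerm 1 (1 / 2 + (t : ℂ) * I) n).re) :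
    (IsLocalMin hardyZ t ∧ 0 < hardyZ t) ∨ (IsLocalMax hardyZ t ∧ hardyZ t < 0) := by
  have hprod := wrongCurvature_of_energyDeficit D ht hd hZ hE
  have hc : ContinuousAt hardyZ t := continuous_hardyZ.continuousAt
  rcases lt_or_gt_of_ne hZ with hneg | hpos
  · right
    have hdd : deriv (deriv hardyZ) t < 0 := by
      by_contra hge
      push Not at hge
      have := mul_nonpos_of_nonpos_of_nonneg hneg.le hge
      linarith
    exact ⟨isLocalMax_of_deriv_deriv_neg hdd hd hc, hneg⟩
  · left
    have hdd : 0 < deriv (deriv hardyZ) t := by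
      by_contra hle
      push Not at hle
      have := mul_nonpos_of_nonneg_of_nonpos hpos.le hle
      linarith
    exact ⟨isLocalMin_of_deriv_deriv_pos hdd hd hc, hpos⟩

/-- **The stub at `t ≥ 6`, decided by the zeros up to a window of width `2/(t²+¼)` (RH-free):** at a
critical point `t ≥ 6` with `Z(t) ≠ 0`, writing `R(t) = Σₙ Re Zₙ(1, ½+it)` (minus the zero energy):
`R(t) < −3/(t²+¼) ⇒ Z·Z'' < 0` and `R(t) > −1/(t²+¼) ⇒ Z·Z'' > 0`. Only the sliver
`−3/(t²+¼) ≤ R(t) ≤ −1/(t²+¼)` is undecided by these bounds (the exact threshold is `−c'(t)`,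
`laguerreAtCritical_iff_energy`). Bookkeeping; the stub stays OPEN; nothing here bears on the truth of
RH. [cite: Ivic2003, §2 Prop. 1 (energy form)] -/
theorem laguerreAtCritical_energy_dichotomy {t : ℝ} (ht : 6 ≤ t) (hd : deriv hardyZ t = 0)
    (hZ : hardyZ t ≠ 0) :
    (∑' n, (D.zeroTerm 1 (1 / 2 + (t : ℂ) * I) n).re < -(3 / (t ^ 2 + 1 / 4)) →
        hardyZ t * deriv (deriv hardyZ) t < 0) ∧
      (-(1 / (t ^ 2 + 1 / 4)) < ∑' n, (D.zeroTerm 1 (1 / 2 + (t : ℂ) * I) n).re →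
        0 < hardyZ t * deriv (deriv hardyZ) t) :=
  ⟨laguerreAtCritical_of_energy_sharp D ht hd hZ, wrongCurvature_of_energyDeficit D ht hd hZ⟩

/-- **Sharp ENERGY LOCATOR (RH-free):** a wrong-curvature or degenerate critical point of `Z` at `t ≥ 6`
(`Z' = 0`, `Z ≠ 0`, `Z·Z'' ≥ 0`) has total zero energy at most `3/(t²+¼)`:
`−3/(t²+¼) ≤ Σₙ Re Zₙ(1, ½+it)` (was `−4/t`, `tsum_re_zeroTerm_ge_of_wrongCurvature`). Nothing here bears
on the truth of RH. [cite: Ivic2003, §2 Prop. 1 (energy form)] -/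
theorem tsum_re_zeroTerm_ge_of_wrongCurvature_sharp {t : ℝ} (ht : 6 ≤ t) (hd : deriv hardyZ t = 0)
    (hZ : hardyZ t ≠ 0) (hL : 0 ≤ hardyZ t * deriv (deriv hardyZ) t) :
    -(3 / (t ^ 2 + 1 / 4)) ≤ ∑' n, (D.zeroTerm 1 (1 / 2 + (t : ℂ) * I) n).re := by
  by_contra hlt
  push Not at hlt
  exact absurd hL (not_le.2 (laguerreAtCritical_of_energy_sharp D ht hd hZ hlt))

/-- **Right curvature forces an energy surplus (RH-free, the converse locator):** at a critical point
`t ≥ 6` with `Z(t) ≠ 0` and `Z(t)·Z''(t) ≤ 0` (in particular wherever the stub's conclusion holds), the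
total zero energy is at least the drift floor: `Σₙ Re Zₙ(1, ½+it) ≤ −1/(t²+¼)`. So under `SigmaL`-type
hypotheses every critical point of `Z` carries POSITIVE zero energy — a necessary condition on the zeros
readable without RH. Nothing here bears on the truth of RH. [cite: Ivic2003, §2 Prop. 1 (energy form)] -/
theorem tsum_re_zeroTerm_le_of_rightCurvature {t : ℝ} (ht : 6 ≤ t) (hd : deriv hardyZ t = 0)
    (hZ : hardyZ t ≠ 0) (hL : hardyZ t * deriv (deriv hardyZ) t ≤ 0) :
    ∑' n, (D.zeroTerm 1 (1 / 2 + (t : ℂ) * I) n).re ≤ -(1 / (t ^ 2 + 1 / 4)) := by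
  by_contra hlt
  push Not at hlt
  exact absurd hL (not_le.2 (wrongCurvature_of_energyDeficit D ht hd hZ hlt))

/-! ## §10. Bridge to the `IsHadamardSeq` zero sum `Σₙ pairTerm b n u` of the window theorems -/
/-- **The window theorems' zero sum has the same derivative.** For a Hadamard sequence `b` of `ξ`
(`IsHadamardSeq 0 b`, the enumeration used by `SigmaLRung.hasSum_pairTerm`, `localIvic`, the cone
decrement lemmas) and any Hadamard datum `D`: at `t` with `Z(t) ≠ 0`, `u ↦ Σₙ pairTerm b n u` is
differentiable at `t` with derivative `Σₙ Re Zₙ(1, ½+it)` — both enumerate the same zero multiset, and near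
`t` the sum IS `−Im ξ'/ξ(½+iu)` (`SigmaLRung.hasSum_pairTerm`). Lets the decrement/cone files and the energy
files be combined. Nothing here bears on the truth of RH. [cite: Ivic2003, §2 (2.1)] -/
theorem hasDerivAt_tsum_pairTerm {b : ℕ → ℂ} (hb : IsHadamardSeq 0 b) {t : ℝ} (hZ : hardyZ t ≠ 0) :
    HasDerivAt (fun u : ℝ ↦ ∑' n, SigmaLRung.pairTerm b n u)
      (∑' n, (D.zeroTerm 1 (1 / 2 + (t : ℂ) * I) n).re) t := by
  refine (hasDerivAt_neg_im_logDeriv_riemannXi D (riemannXi_critLine_ne_zero hZ)).congr_of_eventuallyEq ?_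
  have hev : ∀ᶠ u in 𝓝 t, hardyZ u ≠ 0 := (continuous_hardyZ.continuousAt).eventually_ne hZ
  filter_upwards [hev] with u hu
  exact (SigmaLRung.hasSum_pairTerm hb (riemannXi_critLine_ne_zero hu)).tsum_eq

end Summit.RiemannHypothesis.RiemannHypothesis.Theorems.SigmaLBirth

end
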